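import Literature.NumberTheory.EllipticCurves.PAdicLFunctionMultiplicativeInterpolation
import HarnessLib

/-!
# Skinner 2016, Theorem A at a prime `p ‖ N`: the cyclotomic main conjecture for an elliptic curve
# with multiplicative reduction at `p ≥ 3` under (irr) + (ram) (named fact)

Topic `Literature/NumberTheory/EllipticCurves` (cluster `Skinner2016`, companion of
`Skinner2016/RankZeroPPart.lean` = Theorem C). ONE named fact (nothing asserted) and bookkeeping
projections; no other content. HONEST FRAMING (BSD rank-≤1 residual cell `b2b-bsdres`, unit
`b2b-bsdres-x11a` gen 5): the cell deletes the COMBINATION-SHAPED residual classes of the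
rank-`≤ 1` BSD formula STRICTLY from published theorems and TYPES the remainder; this file supplies
the PUBLISHED divisibility input (indeed the full main conjecture) of the per-curve `p`-adic
certificate lever (`Rank1Residual/Typed/PAdicCertificateEngine.lean`, p179575) at a prime `p ‖ N`
on the (ram) locus — with NO semistability hypothesis —; it is not a class theorem and nothing
here is "finishing BSD".

Source (held: `paper:arxiv-1407.1093`): C. Skinner, *Multiplicative reduction and the cyclotomic
main conjecture for* `GL₂`, Pacific J. Math. 283 (2016), no. 1, 171–200,
doi:10.2140/pjm.2016.283.171 (= arXiv:1407.1093).

**Theorem A, as printed** (§1; [corpus:paper:arxiv-1407.1093 p0003 L29–L43]): "Let `p ≥ 3` be a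
prime. Let `f ∈ S_k(Γ₀(N))` be a newform and let `L` and `𝒪` be as above and suppose `f` is
ordinary at `p` with respect to `L`. If (i) `k ≡ 2 (mod p-1)`; (ii) the reduction `ρ̄_f` of the
representation `ρ_f : Gal(ℚ̄/ℚ) → Aut_𝒪(T_f)` modulo the maximal ideal of `𝒪` is irreducible;
(iii) there exists a prime `q ≠ p` such that `q ‖ N` and `ρ̄_f` is ramified at `q`, then
`Ch_L(f) = (𝓛_f)` in `Λ_𝒪`. That is, the Iwasawa–Greenberg Main Conjecture is true." Here
`Ch_L(f)` is the characteristic ideal of the Pontryagin dual `X_{ℚ_∞,L}(f)` of the Iwasawa–Greenberg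
Selmer group (§2.3: local condition at `p` the kernel to `H¹(I_p, ℳ⁻)^{G_ℚp}`), `𝓛_f ∈ Λ_𝒪` the
`p`-adic `L`-function normalised by the canonical period `Ω_f^+` (§2.4), and (§3.1, [p0013 L11])
"So we assume that `p ∣ N`. By Lemma (ordlemma) we then have `N = pM` with `p ∤ M` and `k = 2`".

**The classical Selmer group and the exceptional zero, as printed** (§2.3 [p0008 L1–L4]: `𝒮` "the
kernel of (restrict-eq1)", i.e. of `H¹(G_S, ℳ) → H¹(ℚ_p, ℳ⁻) × ∏_{ℓ ≠ p} H¹(I_ℓ, ℳ)^{G_ℚℓ}` —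
the STRICT local condition `im H¹(ℚ_p, ℳ⁺)` at `p` —, `𝒳` its Pontryagin dual; §3.2
[p0014 L12–L40], derived under the hypotheses of Theorem B — for `f = f_E` those of Theorem A plus
the non-vanishing of the `𝓛`-invariant at a split `p`, "known if `f` is the modular form associated
to an elliptic curve" [p0003 L107–L110] —, Theorem B's case distinction `L(f,1) = 0 / ≠ 0` entering
only afterwards): "there is an exact sequence
`0 → 𝒮 → Sel_{ℚ_∞,L}(f) → H¹(𝔽_p, (ℳ⁻)^{I_p}) → 0` … `H¹(𝔽_p, (ℳ⁻)^{I_p}) = 0` unless `α_p = 1`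
(i.e., unless `f` has split multiplicative reduction at `p`), in which case it is isomorphic to
`L/𝒪`. Letting `Ch_L(f)'` be the `Λ_𝒪`-characteristic ideal of `𝒳`, it follows that
`Ch_L(f) = Ch_L(f)' · (γ - 1)` [split multiplicative] / `· 1` [otherwise] … In fact, we then have
`Ch_L(f)' = (𝓛_f')` [split multiplicative] / `(𝓛_f)` [otherwise]", where (§2.4 [p0010 L88–L91])
"`𝓛_f = (γ-1) · 𝓛_f'` for some `𝓛_f' ∈ Λ_𝒪`" at a split multiplicative `p`.

**Periods, as printed** (§3.3, proof of Theorem C [p0016 L14–L40]): for `f` the newform of an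
elliptic curve `E/ℚ` with `ord_p(N) ≤ 1` and `E[p]` irreducible, "`Ω_E` is a `ℤ_(p)^×`-multiple of
`-2πi Ω_f^+`" (Greenberg–Vatsal + Stevens' optimal parametrisation + an isogeny of degree prime to
`p`), `Ω_E` the Néron period.

**Transcription** (`thmA_charIdeal_multiplicative`), for `f = f_E` the newform of an elliptic
curve `E/ℚ` (`L = ℚ_p`, `𝒪 = ℤ_p`, `T_f = T_pE`, unique up to scalars by (ii) — Lemma
(lattice-lem) —, `Λ_𝒪 = Λ = ℤ_p⟦T⟧`, `T = γ - 1`), in the vocabulary of the tree's transcriptions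
of Kato Thm. 17.4 (`kato_divisibility`), Wuthrich 2014 Thm. 16 / Cor. 19 and Skinner 2016 Thm. C:
`W` a globally minimal model, `p ≥ 3` a prime of multiplicative reduction (`p ‖ N`; ordinarity
`a_p = ±1 ∈ ℤ_pˣ` and (i) `k = 2` are then automatic), (ii) = `HasIrreducibleModPGaloisRep`,
(iii) = "a prime `ℓ ≠ p` of multiplicative reduction with `p ∤ v_ℓ(Δ_min)`" (Tate; literally the
binder of `Skinner2016.thmC_padicValRat_bsd_rank_zero` and of `Rank1Residual.Ram`), `κ` the
cyclotomic `ℤ_p`-extension with topological generator `γ` matching the cyclotomic variable,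
`D : W.SelmerDualData κ γ` a Pontryagin-dual datum of the CLASSICAL Selmer group
`Sel_{p^∞}(E/ℚ_∞)` — which IS Skinner's `𝒮` for `T_f = T_pE`: at the prime `η ∣ p` of `ℚ_∞` the
Kummer condition equals the image of `H¹(·, C_p)`, `C_p = 𝓕(𝔪̄)[p^∞] = T⁺ ⊗ ℚ_p/ℤ_p`
(Greenberg, LNM 1716, §2 Prop. 2.4 and §3, PDF p. 91: "`Im(κ_η) = Im(λ_η)`" at a multiplicative
`v ∣ p`), and at `η ∤ p` both conditions are "unramified" (loc. cit. Prop. 2.1, `Im(κ_η) = 0`,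
and `H¹(ℚ_{∞,η}, W) ↪ H¹(I_ℓ, W)`); this is the identification already used by the tree for
Kato's and Wuthrich's theorems, whose `X(E)` is the same classical dual —, `ϖ ∈ ℚˣ` with
`ϖ · Ω_E = Ω⁺_f` (`plusPeriod f`, the real period of the optimal curve `ℂ/Λ_f` including real
components; `ϖ ≠ 0` keeps the junk case of `plusPeriod` out), and `L` THE `Ω⁺_f`-normalised
`p`-adic `L`-function of Mazur–Tate–Teitelbaum at the multiplicative prime
(`IsSplitMultPAdicLFunctionOf f p L` at a split `p`, `IsMultPAdicLFunctionOf f p (-1) L` at a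
non-split `p`; unique by boundedness). Skinner's `𝓛_f` and `ϖ · L` are both characterised by
interpolation at all finite-order characters of `Γ` and differ by the constant
`Ω⁺_f / (-2πi Ω_f^+ · ϖ) = Ω_E/(-2πi Ω_f^+) ∈ ℤ_(p)^×` (§3.3) and by convention units (signs,
Gauss-sum normalisation, at a non-split `p` possibly the unit `1 - α_p⁻¹ = 2`), all absorbed in a
unit `w ∈ Λˣ`. CONCLUSION: `X(E/ℚ_∞)` is `Λ`-torsion (Theorem A: `X_{ℚ_∞,L}(f)` torsion, `𝒳` a
quotient) and `char_Λ X(E/ℚ_∞) = (g)` with `ι(T · g · w) = ϖ · L` at a split `p`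
(`Ch' = (𝓛_f')`, `𝓛_f = (γ-1)𝓛_f'`), resp. `ι(g · w) = ϖ · L` at a non-split `p`
(`Ch' = (𝓛_f)`), for some unit `w ∈ Λˣ` (`ι = iwasawaToPowerSeries p`). Both inclusions are
transcribed (an equality of principal ideals), not only Kato's direction.

Use (cell `b2b-bsdres`, REPORT-g5.md): the projection `exists_engine_shape_split` /
`exists_engine_shape_nonsplit` is the input `hι` (`e = 1` / `e = 0`, `c = ϖ`) of
`Typed.padicValNat_card_shaPrimary_le_of_leadingTerm_shape`, for EVERY curve on the (ram) locus —
semistable or not —, superseding there the semistable-only input Wuthrich 2014 Cor. 19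
(`corollary19_splitMultiplicative`, p179618); the torsion clause discharges, with the tree theorems
`mordellWeilRank_le_coinvariantsRank` and `coinvariantsRank_le_order_of_mem_charIdeal`, the input
`T^{rank} ∣ f_E` of the engine (`Typed/PAdicCertificateMultiplicative.lean`). The remaining
class-level input of that lever at `p ‖ N` (J. W. Jones, Duke Math. J. 59 (1989): the algebraic
leading term) is not held (acq-07893) and stays a hypothesis there.

References: [Skinner2016PacificMC] Thm. A (§1), §2.3 (Selmer groups, `𝒮`, Prop. 4–5), §2.4
(`𝓛_f`, `𝓛_f'`, Greenberg–Stevens), §3.1 (proof of Thm. A), §3.2 (the displayed factorisation),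
§3.3 (periods); [GreenbergLNM1716] §2 Props. 2.1, 2.2, 2.4, §3 PDF pp. 90–94 (multiplicative `v ∣ p`,
Prop. 3.7), Thm. 1.14 (involution invariance of `char X`); [MazurTateTeitelbaum1986] §I.10, §I.14,
§I.17; [GreenbergVatsal2000] (periods); [Wuthrich2014] Cor. 19 (the semistable special case of the
divisibility half).
-/

set_option autoImplicit false

noncomputable section

open scoped Classical MatrixGroups ModularForm

open CongruenceSubgroup WeierstrassCurve Literature.NumberTheory.EllipticCurves
  Literature.NumberTheory.EllipticCurves.ModularForms

namespace Literature.NumberTheory.EllipticCurves.Skinner2016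

/-- **Skinner 2016, Theorem A at `p ‖ N` (with the factorisation of §3.2 and the period comparison
of §3.3), for the newform of an elliptic curve: `char_Λ X(E/ℚ_∞)` is generated by the `p`-adic
`L`-function (up to the exceptional-zero factor `T`) at a multiplicative prime `p ≥ 3` under
(irr) + (ram).** As printed (Pacific J. Math. 283 (2016), Thm. A,
§1): "Let `p ≥ 3` be a prime. Let `f ∈ S_k(Γ₀(N))` be a newform … ordinary at `p` … If (i)
`k ≡ 2 (mod p-1)`; (ii) … `ρ̄_f` … is irreducible; (iii) there exists a prime `q ≠ p` such that
`q ‖ N` and `ρ̄_f` is ramified at `q`, then `Ch_L(f) = (𝓛_f)` in `Λ_𝒪`"; §3.2: "Letting `Ch_L(f)'`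
be the `Λ_𝒪`-characteristic ideal of `𝒳` [the dual of the strict = classical Selmer group `𝒮`] …
`Ch_L(f) = Ch_L(f)' · (γ-1)` [split] … In fact, we then have `Ch_L(f)' = (𝓛_f')` [`f` split
multiplicative at `p`, `𝓛_f = (γ-1)·𝓛_f'`] / `(𝓛_f)` [otherwise]"; §3.3: "`Ω_E` is a
`ℤ_(p)^×`-multiple of `-2πi Ω_f^+`" (for `ord_p(N) ≤ 1`, `E[p]` irreducible).
Transcription (module docstring): `W` globally minimal, `3 ≤ p`, multiplicative reduction at `p`,
`E[p]` irreducible, (ram) `∃ ℓ ≠ p` multiplicative with `p ∤ v_ℓ(Δ_min)`, cyclotomic `κ` with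
topological generator `γ` matching the cyclotomic variable, `f` the newform of `W`, `D` a
Pontryagin-dual datum of `Sel_{p^∞}(E/ℚ_∞)` (= Skinner's `𝒮`, Greenberg LNM 1716 §2–3),
`ϖ ∈ ℚˣ` with `ϖ · Ω_E = Ω⁺_f`. Conclusion: `X(E/ℚ_∞)` is `Λ`-torsion and `char_Λ X = (g)` where,
for a unit `w ∈ Λˣ`, `ι(T · g · w) = ϖ · L` for THE split-multiplicative `p`-adic `L`-function `L`
(`IsSplitMultPAdicLFunctionOf f p L`) if `p` is split, and `ι(g · w) = ϖ · L` for THE non-split one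
(`IsMultPAdicLFunctionOf f p (-1) L`) otherwise. Named fact; nothing asserted (inputs: Kato's Euler
system, Skinner–Urban, Hida theory, Rohrlich — none in Mathlib or the tree).
PROOF-INPUT FLAG `SU14-12.3.6-mu@nonsplit@3` (a docstring flag priced by the referee desks on the
`p = 3` INSTANTIATION — NOT a statement change; the statement above is print's for every `3 ≤ p`;
referee A R152.2, referee C2 R334.3 (β) / R337.3 (β)(γ) = wording of record; ARM-P reader sheets
D-AUDIT-r03 `11b71c810fa7250e`, D-AUDIT-r04 `770d5e7dd36f5860`, D-AUDIT-r20-Sk16C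
`db467065daea6044`; cell bsd-stepL-plan's R-01 answer). PRINT PROOF CHAIN: Thm. A at `p ‖ N`
(§3.1 [corpus:paper:arxiv-1407.1093 p0013:L11–L38]) ⟶ the Hida family of `f_E`: members `f_m` of
level `M`, `p ∤ M`, items (a)(d)(e), "(e) and (f) follow from the Iwasawa–Greenberg Main Conjecture
for `f_m` (which holds by (a), (d), and Theorem (MCthm1) since `f_m` is of level `M` and `p ∤ M`)"
⟶ Thm. 9 (= journal Thm. 2.5.2) = "[SU-MCGL] Thm. 1 … in combination with results of Kato"
[p0011:L9–L21] ⟶ "The main results of [SU-MCGL] show that for a suitable imaginary quadratic field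
`K` and a large enough set `Σ`, the equality `Ch(f)Ch(f ⊗ χ_K) = (𝓛_f 𝓛_{f⊗χ_K})` holds"
[p0011:L55–L61] = Skinner–Urban's three-variable main conjecture ⟶ S–U Prop. 13.4.1 (ii) "follows
from part (i) and Proposition 12.3.6" [corpus:paper:doi-10-1007-s00222-013-0448-1 p0218:L5] ⟶
Prop. 12.3.6 = the µ-transfer of ¶12.3.5 ("the µ-invariant of `𝓛^{Σ,−}_{f,K,ξ}` is zero. That is,
some `φ(a_i) ∈ A^×`" [p0202:L16–L29, L52–L57]). STATUS OF THAT STEP (referee wording of record):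
at `p ≥ 5` — flag `SU14-12.3.6-mu@nonsplit` INFORMATIONAL (C2 R337.3 (β), verbatim): «informational:
µ-transfer of ¶12.3.5/Prop 12.3.6 repaired in refereed print for p ≥ 5 — @Wan15-L87/T101 (repair
printed inside Wan's framework; F = ℚ transposition = INFERENCE, no authors' erratum) | independent
cover Thm103 = Thm 4 ⇐ [Fuj06, unpublished] + [BCS25] Hyp 3.1.1 (H1) (met for surjective ρ̄_{E,p},
hence on RowC1's good branch and all A1 instances)» (Wan, Forum Math. Sigma 3
(2015): Thm. 86 "Assume that p ⩾ 5", Lemma 87 ⇐ Remark 83 + Thm. 86, Thm. 101 / Thm. 103 "Suppose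
that p ⩾ 5" [corpus:paper:wan2015-iwasawa-main-conjecture-hilbert-modular-forms p0070:L5,
p0071:L2–L14, p0088:L30, p0089:L47, p0091:L42]); at `p = 3` — flag `SU14-12.3.6-mu@nonsplit@3`
**ACTIVE-PRINT-GAP** (R152.2 = R334 = R337, three independent desk readings): in S–U's proof the
(ram) prime `q` is chosen inert in `K` with `q ∈ Σ`, the `w ∣ q` factor of (12.3.5.b) is
`(q² − 1)/q²`, and `3 ∣ q² − 1` for every prime `q ≠ 3`, so the µ-sentence of Prop. 12.3.6 fails in
EVERY `p = 3` instance; refereed repair at `3`: NONE located (Wan's Thm. 86 excludes `3` inside its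
proof; BCS IMRN 2025 is `p > 3`; no S–U erratum; no non-[SU] road at a multiplicative `3 ∣ N` is
announced anywhere — BSTW arXiv:2409.01350v2 Thm. 10.10 (a) (zeta elements, PRE) needs `p ∤ 2N` with
`N` square-free, and BSTW's own Thm. 9.21 (c) / Thm. 12.3 at `p = 3` run through [SU] Thm. 3.29
under (ram)). CONSUMERS AT 3: route items stmt-BirchSwinnertonDyer-19402
`SkinnerMultiplicativeMainConjecture := thmA_charIdeal_multiplicative` (Theses/ClassRecordThree.lean,
Theses/KolyvaginRoadThree.lean; children of 19112 / 19156) instantiate THIS fact at `p = 3`, `3 ‖ N`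
— inside its printed range `3 ≤ p` —, so the flag TRAVELS with those uses and is priced there by the
C-desk / referee A (PUB at `p ≥ 5`, PUB\* at `p = 3`; no class is created or deleted by the flag).
RETIREMENT (R152.2 (g)): a refereed `p = 3` lower divisibility over `ℚ` — BSTW journal version, an
S–U erratum, or an `F = ℚ` Lemma-87 analogue without `p ⩾ 5`; typed retirement-target family of
record (CITED-FACTS-v2 §5 R-01; EXISTING decls, no new fact): THIS decl at `p = 3` (multiplicative
`3`) ∥ `skinner_urban_main_conjecture W 3` (good ordinary `3`; G1
`SkinnerUrban2014_thm369_cyclotomicMainConjecture_at_three` its corollary form, G2 = the S–U lower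
half at `3` the item of record). Skinner's own text is NOT the locus of the gap (his §2.5 repair of
Kato's image hypothesis rests on Kato's printed 12.4 (3) / 13.4 (3)); the gap is inherited from
[SU-MCGL].
-- TODO(general form): Theorem A is printed for `p`-ordinary newforms `f ∈ S_k(Γ₀(N))` of any
-- weight `k ≡ 2 (mod p-1)` with coefficients in `𝒪`, for the Iwasawa–Greenberg Selmer group and
-- any finite set `Σ` of auxiliary primes; only `f = f_E`, `p ‖ N`, `Σ = {p}`, `𝒪 = ℤ_p` is here.
[cite: Skinner2016PacificMC, Thm. A (§1), §2.3, §2.4, §3.2, §3.3]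
[cite: GreenbergLNM1716, §2 Props. 2.1–2.4 and §3 PDF p. 91] -/
def thmA_charIdeal_multiplicative : Prop :=
  ∀ (W : WeierstrassCurve ℚ) [W.IsElliptic] [W.IsGloballyMinimal] (p : ℕ) [Fact p.Prime]
    {κ : ZpExtension ℚ p} {γ : Field.absoluteGaloisGroup ℚ} {N : ℕ} [NeZero N]
    {f : CuspForm (Gamma0 N) 2},
    3 ≤ p → W.HasMultiplicativeReductionAtPrime p → W.HasIrreducibleModPGaloisRep p →
    (∃ ℓ : ℕ, ∃ _ : Fact ℓ.Prime, ℓ ≠ p ∧ W.HasMultiplicativeReductionAtPrime ℓ ∧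
      ¬ p ∣ padicValInt ℓ W.minimalDiscriminantInt) →
    κ.IsCyclotomic → κ.IsTopGenerator γ → IsCyclotomicVariable p γ → IsNewformOf W f →
    ∀ (D : W.SelmerDualData κ γ) (ϖ : ℚ), ϖ ≠ 0 → (ϖ : ℝ) * W.realPeriodRat = plusPeriod f →
      D.IsTorsion ∧ ∃ g : IwasawaAlgebra p, D.charIdeal = Ideal.span {g} ∧
        (W.HasSplitMultiplicativeReductionAtPrime p →
          ∀ L : PowerSeries ℚ_[p], IsSplitMultPAdicLFunctionOf f p L →
            ∃ w : (IwasawaAlgebra p)ˣ,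
              iwasawaToPowerSeries p ((PowerSeries.X : IwasawaAlgebra p) * g * (w : IwasawaAlgebra p)) =
                PowerSeries.C ((ϖ : ℚ) : ℚ_[p]) * L) ∧
        (¬ W.HasSplitMultiplicativeReductionAtPrime p →
          ∀ L : PowerSeries ℚ_[p], IsMultPAdicLFunctionOf f p (-1) L →
            ∃ w : (IwasawaAlgebra p)ˣ,
              iwasawaToPowerSeries p (g * (w : IwasawaAlgebra p)) = PowerSeries.C ((ϖ : ℚ) : ℚ_[p]) * L)

/-! ### Projections of the fact -/

namespace thmA_charIdeal_multiplicative

variable (hA : thmA_charIdeal_multiplicative)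
  (W : WeierstrassCurve ℚ) [W.IsElliptic] [W.IsGloballyMinimal] (p : ℕ) [Fact p.Prime]
  {κ : ZpExtension ℚ p} {γ : Field.absoluteGaloisGroup ℚ} {N : ℕ} [NeZero N]
  {f : CuspForm (Gamma0 N) 2} (hp : 3 ≤ p) (hmult : W.HasMultiplicativeReductionAtPrime p)
  (hirr : W.HasIrreducibleModPGaloisRep p)
  (hram : ∃ ℓ : ℕ, ∃ _ : Fact ℓ.Prime, ℓ ≠ p ∧ W.HasMultiplicativeReductionAtPrime ℓ ∧
    ¬ p ∣ padicValInt ℓ W.minimalDiscriminantInt)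
  (hκ : κ.IsCyclotomic) (hγ : κ.IsTopGenerator γ) (hγ' : IsCyclotomicVariable p γ)
  (hf : IsNewformOf W f) (D : W.SelmerDualData κ γ) (ϖ : ℚ) (hϖ0 : ϖ ≠ 0)
  (hϖ : (ϖ : ℝ) * W.realPeriodRat = plusPeriod f)

include hA hp hmult hirr hram hκ hγ hγ' hf hϖ0 hϖ

/-- Theorem A, first clause: `X(E/ℚ_∞)` is a torsion `Λ`-module at a multiplicative `p ≥ 3` under
(irr) + (ram). [cite: Skinner2016PacificMC, Thm. A (§1) and §3.1] -/
theorem isTorsion : D.IsTorsion :=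
  (hA W p hp hmult hirr hram hκ hγ hγ' hf D ϖ hϖ0 hϖ).1

/-- **Split multiplicative `p`: the divisibility half in the shape of the `p`-adic certificate
engine** — a generator `fE` of `char_Λ X(E/ℚ_∞)`, an element `g ∈ (fE)` and
`ϖ · L = T¹ · ι(g)` (input `hι` of `Typed.padicValNat_card_shaPrimary_le_of_leadingTerm_shape`
with `e = 1`, `c = ϖ`). [cite: Skinner2016PacificMC, Thm. A (§1), §3.2] -/
theorem exists_engine_shape_split (hsplit : W.HasSplitMultiplicativeReductionAtPrime p)
    (L : PowerSeries ℚ_[p]) (hL : IsSplitMultPAdicLFunctionOf f p L) :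
    ∃ fE g : IwasawaAlgebra p, D.charIdeal = Ideal.span {fE} ∧ g ∈ Ideal.span {fE} ∧
      PowerSeries.C ((ϖ : ℚ) : ℚ_[p]) * L = PowerSeries.X ^ 1 * iwasawaToPowerSeries p g := by
  obtain ⟨-, fE, hchar, hsp, -⟩ := hA W p hp hmult hirr hram hκ hγ hγ' hf D ϖ hϖ0 hϖ
  obtain ⟨w, hw⟩ := hsp hsplit L hL
  refine ⟨fE, fE * w, hchar, Ideal.mem_span_singleton'.mpr ⟨(w : IwasawaAlgebra p), mul_comm _ _⟩, ?_⟩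
  rw [← hw, mul_assoc, map_mul, pow_one]
  simp [iwasawaToPowerSeries, PowerSeries.map_X]

/-- **Non-split multiplicative `p`: the divisibility half in the engine's shape** (`e = 0`,
`c = ϖ`: `ϖ · L = T⁰ · ι(g)`, `g ∈ (fE)`, `char_Λ X = (fE)`).
[cite: Skinner2016PacificMC, Thm. A (§1), §3.2] -/
theorem exists_engine_shape_nonsplit (hns : ¬ W.HasSplitMultiplicativeReductionAtPrime p)
    (L : PowerSeries ℚ_[p]) (hL : IsMultPAdicLFunctionOf f p (-1) L) :
    ∃ fE g : IwasawaAlgebra p, D.charIdeal = Ideal.span {fE} ∧ g ∈ Ideal.span {fE} ∧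
      PowerSeries.C ((ϖ : ℚ) : ℚ_[p]) * L = PowerSeries.X ^ 0 * iwasawaToPowerSeries p g := by
  obtain ⟨-, fE, hchar, -, hnsp⟩ := hA W p hp hmult hirr hram hκ hγ hγ' hf D ϖ hϖ0 hϖ
  obtain ⟨w, hw⟩ := hnsp hns L hL
  exact ⟨fE, fE * w, hchar, Ideal.mem_span_singleton'.mpr ⟨(w : IwasawaAlgebra p), mul_comm _ _⟩,
    by rw [← hw, pow_zero, one_mul]⟩

/-- **Split multiplicative `p`: Kato's direction in the shape of Wuthrich's Cor. 19** —
`ι(T · g) = ϖ · L` for some `g ∈ char_Λ X(E/ℚ_∞)` —, WITHOUT the semistability hypothesis of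
`Wuthrich2014.corollary19_splitMultiplicative`, on the (ram) locus.
[cite: Skinner2016PacificMC, Thm. A (§1), §3.2] -/
theorem exists_mem_charIdeal_split (hsplit : W.HasSplitMultiplicativeReductionAtPrime p)
    (L : PowerSeries ℚ_[p]) (hL : IsSplitMultPAdicLFunctionOf f p L) :
    ∃ g ∈ D.charIdeal, iwasawaToPowerSeries p ((PowerSeries.X : IwasawaAlgebra p) * g) =
      PowerSeries.C ((ϖ : ℚ) : ℚ_[p]) * L := by
  obtain ⟨-, fE, hchar, hsp, -⟩ := hA W p hp hmult hirr hram hκ hγ hγ' hf D ϖ hϖ0 hϖ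
  obtain ⟨w, hw⟩ := hsp hsplit L hL
  refine ⟨fE * w, ?_, by rw [← hw, mul_assoc]⟩
  rw [hchar]
  exact Ideal.mem_span_singleton'.mpr ⟨(w : IwasawaAlgebra p), mul_comm _ _⟩

/-- **Non-split multiplicative `p`: Kato's direction in the shape of Wuthrich's Cor. 19** —
`ι g = ϖ · L` for some `g ∈ char_Λ X(E/ℚ_∞)` —, without semistability, on the (ram) locus.
[cite: Skinner2016PacificMC, Thm. A (§1), §3.2] -/
theorem exists_mem_charIdeal_nonsplit (hns : ¬ W.HasSplitMultiplicativeReductionAtPrime p)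
    (L : PowerSeries ℚ_[p]) (hL : IsMultPAdicLFunctionOf f p (-1) L) :
    ∃ g ∈ D.charIdeal, iwasawaToPowerSeries p g = PowerSeries.C ((ϖ : ℚ) : ℚ_[p]) * L := by
  obtain ⟨-, fE, hchar, -, hnsp⟩ := hA W p hp hmult hirr hram hκ hγ hγ' hf D ϖ hϖ0 hϖ
  obtain ⟨w, hw⟩ := hnsp hns L hL
  refine ⟨fE * w, ?_, hw⟩
  rw [hchar]
  exact Ideal.mem_span_singleton'.mpr ⟨(w : IwasawaAlgebra p), mul_comm _ _⟩

end thmA_charIdeal_multiplicative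

end Literature.NumberTheory.EllipticCurves.Skinner2016

end
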